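import Literature.NumberTheory.GelbartRogawski1991.DoubledWeilRepresentationUndoublingTensor
import Literature.NumberTheory.GelbartRogawski1991.DoubledWeilRepresentationArchHalfExplicit
import HarnessLib

/-!
# Undoubling an ARCHIMEDEAN operator through `ω(u(g))(Φ₁ ⊠ Φ₂) = ω(s(g))Φ₁ ⊠ Φ₂`
# ([Kudla1994, §2 and Thm. 3.1]: the doubled Weil representation restricted to `G × 1` on product vectors)

Topic `NumberTheory/GelbartRogawski1991`; namespace `Literature.NumberTheory.GelbartRogawski1991.GRConstruction`.  KERNEL ONLY: proved
theorems; 0 definitions, 0 records, 0 named facts, 0 `sorry`.  Sequel of `DoubledWeilRepresentationUndoublingTensor` (the FINITE-operator case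
`omega_uD_tensorToSum_tmul`): the ARCHIMEDEAN-operator case and the resulting eigenvalue transfer to the undoubled section.

* § 1 `omega_uD_tensorToSum_tmul_of_arch`: if `ω(sD (g ⊕ 1)) = A ⊗ 1` on pure tensors (e.g. `sD (g ⊕ 1)` an archimedean half `archLift …` twisted by a
  scalar: `Weil1964.omega_archLift`), then `ω(u(g))((a₁ ⊗ f₁) ⊠ (a₂ ⊗ f₂)) = R_{e₂⁻¹} (A (R_{e₂}^∞ (a₁ ⊠_∞ a₂)) ⊗ R_{e₂}^f (f₁ ⊠_f f₂))`.
* § 2 **`omega_undouble_tmul_eq_smul_of_arch`**: if moreover `A` has the doubled archimedean vector `R_{e₂}^∞ (a₁ ⊠_∞ a₂)` as an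
  EIGENVECTOR, `A (R_{e₂}(a₁ ⊠ a₂)) = λ • R_{e₂}(a₁ ⊠ a₂)`, and `a₂ ⊗ f₂ ≠ 0`, then the undoubled section has `a₁ ⊗ f₁` as an eigenvector with
  the SAME eigenvalue: `ω(undouble g)(a₁ ⊗ f₁) = λ • (a₁ ⊗ f₁)` (`omega_uD_tensorToSum` + `⊠`-cancellation).  This is the
  «undoubling of the vacuum» step of the COR-CM X3-Char item (E) kernel route: with `sD := doubledWeilRep χ` (so `undouble = chiSplitting χ`,
  `chiSplitting_eq_undoubleHom`), `A ⊗ 1 = ω(archHalfOf t k)` (`doubledWeilRep_archToAdelic_eq_archHalfOf`), `λ = η_t(k) · vac (sectionD k)`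
  (`omega_archHalfOf_gaussian_tmul`, `Weil1964.vac_archWeilSectionS_of_kV`) and `R_{e₂}(G_𝕍 ⊠ G_{−𝕍}) = G^𝔻` (the Gaussian of the doubled
  frame factorises), it reads the archimedean CENTRAL TYPE of `ι_χ` on the pair Gaussian.  Those instantiations are the consumer's; this file
  is generic in `sD`, `A`, `λ`.
* § 3 `omega_archHalfOf_tmul`: the hypothesis of § 1–§ 2 for the explicit archimedean half `archHalfOf t k`
  (`DoubledWeilRepresentationArchHalfExplicit`): `ω(archHalfOf t k)(a ⊗ f) = η_t(k) • ((e^* s^𝔻(k) e_* a) ⊗ f)` (`c = η_t(k)`, `A = e^* s^𝔻(k) e_*`).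

HC_CM is NOT proved here or anywhere in the tree.  References: S. Kudla, Israel J. Math. 87 (1994), §2, Thm. 3.1 [Kudla1994]; A. Weil, Acta
Math. 111 (1964), n° 29, Chap. III n° 37–38 [Weil1964]; M. Harris, S. Kudla, W. Sweet, J. AMS 9 (1996), §1 (1.14)–(1.16) [HarrisKudlaSweet1996].
Provenance: pub-hodgecm2 cell, seat item6-p3 (gen 11).
-/

set_option autoImplicit false

noncomputable section

open scoped Classical
open scoped Matrix Kronecker TensorProduct SchwartzMap
open NumberField NumberField.mixedEmbedding IsDedekindDomain
open Literature.RepresentationTheory.HeisenbergGroup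
open Literature.NumberTheory.Automorphic
open Literature.NumberTheory.Weil1964
open Literature.RepresentationTheory.HarrisKudlaSweet1996
open Literature.NumberTheory.GaloisRepresentations

namespace Literature.NumberTheory.GelbartRogawski1991.GRConstruction

open UnitaryDualPair
open Literature.NumberTheory.GelbartRogawski1991.UnitaryDualPair.LocalSplitting

variable (L : Type) [Field L] [NumberField L] [IsCMField L]

variable {N M n : ℕ} (e : Fin N × Fin M ≃ Fin n)
  (dV : Fin N → L) (hdV : ∀ i, IsCMField.complexConj L (dV i) = dV i) (hdV0 : ∀ i, dV i ≠ 0)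
  (dW : Fin M → L) (hdW : ∀ i, IsCMField.complexConj L (dW i) = dW i) (hdW0 : ∀ i, dW i ≠ 0)

variable (sD : HA L e dV hdV dW hdW →* MpD L e dV hdV dW hdW)

/-! ## §1 `ω(u(g))` on pure tensors when `sD (g ⊕ 1)` acts by an archimedean operator -/

/-- **`ω(u(g))` on pure tensors, archimedean-operator case**: if `ω(sD (g ⊕ 1)) = c · (A ⊗ 1)` on pure tensors (`A` any self-map of `𝓢(X_∞)`, `c` a scalar) then
`ω(u(g))((a₁ ⊗ f₁) ⊠ (a₂ ⊗ f₂)) = c • R_{e₂⁻¹} (A (R_{e₂}^∞ (a₁ ⊠_∞ a₂)) ⊗ R_{e₂}^f (f₁ ⊠_f f₂))`.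
[cite: Kudla1994, §2 (doubled space, Siegel parabolic), Thm. 3.1] [cite: Weil1964, Chap. III n° 38 p. 189] -/
theorem omega_uD_tensorToSum_tmul_of_arch
    (g : UnitaryGroup.adelicPair (Fp L) L (IsCMField.complexConj L) N M (Matrix.diagonal dV) (Matrix.diagonal dW))
    {A : 𝓢((Fin (n + n) → mixedSpace (Fp L)), ℂ) → 𝓢((Fin (n + n) → mixedSpace (Fp L)), ℂ)} {c : ℂ}
    (hA : ∀ (a : 𝓢((Fin (n + n) → mixedSpace (Fp L)), ℂ)) (f : FinSB (Fp L) (Fin (n + n))),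
      adelicMpCont.omega (Fp L) (Fin (n + n)) (gramDA L e dV hdV dW hdW) (sD (inlG L e dV hdV dW hdW g))
          (piSchwartzBruhatEquiv (Fp L) (Fin (n + n)) (a ⊗ₜ f)) =
        c • piSchwartzBruhatEquiv (Fp L) (Fin (n + n)) (A a ⊗ₜ f))
    (a₁ a₂ : 𝓢((Fin n → mixedSpace (Fp L)), ℂ)) (f₁ f₂ : FinSB (Fp L) (Fin n)) :
    adelicMpCont.omega (Fp L) (Fin n ⊕ Fin n) (gramS L e dV hdV dW hdW) (uD L e dV hdV dW hdW sD g)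
        (tensorToSum (Fp L) (Fin n) (Fin n) (piSchwartzBruhatEquiv (Fp L) (Fin n) (a₁ ⊗ₜ f₁))
          (piSchwartzBruhatEquiv (Fp L) (Fin n) (a₂ ⊗ₜ f₂))) =
      c • piSBReindex (Fp L) (e₂ (n := n)).symm (piSchwartzBruhatEquiv (Fp L) (Fin (n + n))
        (A (schwartzReindexCLM (Fp L) (e₂ (n := n)) (archBoxTensor a₁ a₂)) ⊗ₜ
          finSBReindex (Fp L) (e₂ (n := n)) (finSumEquiv (Fp L) (Fin n) (Fin n) (f₁ ⊗ₜ f₂)))) := by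
  have h1 := omega_uD_apply L e dV hdV dW hdW sD g
    (tensorToSum (Fp L) (Fin n) (Fin n) (piSchwartzBruhatEquiv (Fp L) (Fin n) (a₁ ⊗ₜ f₁))
      (piSchwartzBruhatEquiv (Fp L) (Fin n) (a₂ ⊗ₜ f₂)))
  have h2 := piSBReindex_tensorToSum_tmul (Fp L) (e₂ (n := n)) a₁ f₁ a₂ f₂
  have h3 : adelicMpCont.omega (Fp L) (Fin (n + n)) (gramDA L e dV hdV dW hdW) (sD (inlG L e dV hdV dW hdW g))
      (piSchwartzBruhatEquiv (Fp L) (Fin (n + n))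
        (schwartzReindexCLM (Fp L) (e₂ (n := n)) (archBoxTensor a₁ a₂) ⊗ₜ
          finSBReindex (Fp L) (e₂ (n := n)) (finSumEquiv (Fp L) (Fin n) (Fin n) (f₁ ⊗ₜ f₂)))) =
      c • piSchwartzBruhatEquiv (Fp L) (Fin (n + n))
        (A (schwartzReindexCLM (Fp L) (e₂ (n := n)) (archBoxTensor a₁ a₂)) ⊗ₜ
          finSBReindex (Fp L) (e₂ (n := n)) (finSumEquiv (Fp L) (Fin n) (Fin n) (f₁ ⊗ₜ f₂))) :=
    hA _ _
  exact (h1.trans (congrArg (piSBReindex (Fp L) (e₂ (n := n)).symm)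
    ((congrArg (adelicMpCont.omega (Fp L) (Fin (n + n)) (gramDA L e dV hdV dW hdW) (sD (inlG L e dV hdV dW hdW g))) h2).trans
      h3))).trans (LinearEquiv.map_smul _ _ _)

/-! ## §2 Eigenvalue transfer to the undoubled section -/

/-- **undoubling an archimedean eigenvalue**: if `ω(sD (g ⊕ 1)) = c · (A ⊗ 1)`, `A (R_{e₂}(a₁ ⊠ a₂)) = λ • R_{e₂}(a₁ ⊠ a₂)` and `a₂ ⊗ f₂ ≠ 0`,
then `ω(undouble g)(a₁ ⊗ f₁) = (c λ) • (a₁ ⊗ f₁)` — the undoubled section `s(g)` (for `sD = doubledWeilRep χ`: `ι_χ(g)`, `chiSplitting_eq_undoubleHom`)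
has `a₁ ⊗ f₁` as an eigenvector with the eigenvalue of the doubled archimedean operator on `R_{e₂}(a₁ ⊠ a₂)`.
[cite: Kudla1994, §2 (doubled space, Siegel parabolic), Thm. 3.1] [cite: HarrisKudlaSweet1996, §1 (1.14)–(1.16)] -/
theorem omega_undouble_tmul_eq_smul_of_arch
    (hproj : ∀ h, projD L e dV hdV dW hdW (sD h) = toSpD L e dV hdV dW hdW h)
    (g : UnitaryGroup.adelicPair (Fp L) L (IsCMField.complexConj L) N M (Matrix.diagonal dV) (Matrix.diagonal dW))
    {A : 𝓢((Fin (n + n) → mixedSpace (Fp L)), ℂ) → 𝓢((Fin (n + n) → mixedSpace (Fp L)), ℂ)} {c : ℂ}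
    (hA : ∀ (a : 𝓢((Fin (n + n) → mixedSpace (Fp L)), ℂ)) (f : FinSB (Fp L) (Fin (n + n))),
      adelicMpCont.omega (Fp L) (Fin (n + n)) (gramDA L e dV hdV dW hdW) (sD (inlG L e dV hdV dW hdW g))
          (piSchwartzBruhatEquiv (Fp L) (Fin (n + n)) (a ⊗ₜ f)) =
        c • piSchwartzBruhatEquiv (Fp L) (Fin (n + n)) (A a ⊗ₜ f))
    (a₁ a₂ : 𝓢((Fin n → mixedSpace (Fp L)), ℂ)) (f₁ f₂ : FinSB (Fp L) (Fin n)) {lam : ℂ}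
    (hlam : A (schwartzReindexCLM (Fp L) (e₂ (n := n)) (archBoxTensor a₁ a₂)) =
      lam • schwartzReindexCLM (Fp L) (e₂ (n := n)) (archBoxTensor a₁ a₂))
    (hne : piSchwartzBruhatEquiv (Fp L) (Fin n) (a₂ ⊗ₜ f₂) ≠ 0) :
    adelicMpCont.omega (Fp L) (Fin n) (gramA L e dV hdV dW hdW) (undouble L e dV hdV hdV0 dW hdW hdW0 hproj g)
        (piSchwartzBruhatEquiv (Fp L) (Fin n) (a₁ ⊗ₜ f₁)) =
      (c * lam) • piSchwartzBruhatEquiv (Fp L) (Fin n) (a₁ ⊗ₜ f₁) := by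
  have h1 := omega_uD_tensorToSum_tmul_of_arch L e dV hdV dW hdW sD g hA a₁ a₂ f₁ f₂
  simp only [hlam, ← TensorProduct.smul_tmul', LinearEquiv.map_smul, piSBReindex_symm_tmul_eq_tensorToSum, smul_smul] at h1
  -- `h1 : ω(u(g))((a₁ ⊗ f₁) ⊠ (a₂ ⊗ f₂)) = λ • ((a₁ ⊗ f₁) ⊠ (a₂ ⊗ f₂))`
  have h3 := omega_uD_tensorToSum L e dV hdV hdV0 dW hdW hdW0 hproj g (piSchwartzBruhatEquiv (Fp L) (Fin n) (a₁ ⊗ₜ f₁))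
    (piSchwartzBruhatEquiv (Fp L) (Fin n) (a₂ ⊗ₜ f₂))
  refine tensorToSum_left_cancel (K := Fp L) hne ?_
  rw [← h3, h1, LinearMap.map_smul₂]

/-! ## §3 The hypothesis for the explicit archimedean half: `ω(archHalfOf t k)(a ⊗ f) = η_t(k) • ((e^* sectionD(k) e_* a) ⊗ f)` -/

/-- **the explicit archimedean half on pure tensors**: `ω(archHalfOf t k)(a ⊗ f) = η_t(k) • ((e^* s^𝔻(k) e_* a) ⊗ f)` — the hypothesis `hA`
of § 1–§ 2 (`c = η_t(k)`, `A = carrierConjEquiv frameD (sectionD k)`) for `sD (g ⊕ 1) = archHalfOf t k` (THE `χ`-normalised doubled Weil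
representation at archimedean elements: `doubledWeilRep_archToAdelic_eq_archHalfOf`).
[cite: GelbartRogawski1991, §3.1 Prop. 3.1.1 p. 455] [cite: Weil1964, Chap. III n° 38 p. 189] -/
theorem omega_archHalfOf_tmul (t : NumberField.InfinitePlace L → ℤ)
    (k : UnitaryGroup.arch (Fp L) L (IsCMField.complexConj L) (n + n) (hermD L e dV hdV dW hdW))
    (a : 𝓢((Fin (n + n) → mixedSpace (Fp L)), ℂ)) (f : FinSB (Fp L) (Fin (n + n))) :
    adelicMpCont.omega (Fp L) (Fin (n + n)) (gramDA L e dV hdV dW hdW) (archHalfOf L e dV hdV hdV0 dW hdW hdW0 t k)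
        (piSchwartzBruhatEquiv (Fp L) (Fin (n + n)) (a ⊗ₜ f)) =
      (((etaD L e dV hdV dW hdW t k : ℂˣ) : ℂ)) • piSchwartzBruhatEquiv (Fp L) (Fin (n + n))
        (carrierConjEquiv
            (scaledFrame (Fp L) (Fin (n + n))
              (placeScale (n + n) fun v => sqrtAbs (signVec (cmPlaceOver L)
                (fun k => Sum.elim (cmGramEntry L e dV hdV dW hdW) (-cmGramEntry L e dV hdV dW hdW) ((LocalSplitting.e₂ n).symm k))
                (imagUnit L) v))
              (placeScale_ne_zero (n + n) (sqrtAbs_signVec_ne_zero (IsCMField.complexConj_ne_one L) (cmPlaceOver_smul L)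
                (complexConj_imagUnit L) (imagUnit_ne_zero L) (gramD_gram_realDiagonal_entry_ne_zero L e dV hdV dW hdW hdV0 hdW0))))
            (archWeilSectionS L (IsCMField.complexConj L) (n + n) (IsCMField.complexConj_ne_one L) (cmPlaceOver L) (cmPlaceOver_smul L)
              (cmPlaceOver_comap L) _ (gramD_gram_realDiagonal_entry_ne_zero L e dV hdV dW hdW hdV0 hdW0)
              (gramD_eq_diagonal_cm L e dV hdV dW hdW) (J := hermD L e dV hdV dW hdW) rfl (complexConj_imagUnit L) (imagUnit_ne_zero L)
              k).1.2 a ⊗ₜ f) := by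
  delta archHalfOf
  rw [adelicMpCont.omega_twist]
  congr 1
  unfold archWeilHalfD archWeilHalf
  exact omega_archLift_tmul _ _ _ _ _ _ _ k a f

end Literature.NumberTheory.GelbartRogawski1991.GRConstruction

end
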